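import Literature.AlgebraicGeometry.Resolution.CharPolyhedronSolvableVertex
import Mathlib.RingTheory.Polynomial.Basic
import HarnessLib

/-!
# [OURS · L1 W4.2] D18 — FACE READING, part 1: the SOLVABLE VERTEX forced by a congruence `f_{j,X} ≡ C(m,j)(−c)^j u_{i₀}^{jr} (mod (u_T))`
# (cell res-hironaka, LADDER-RESOLUTION rung L; slot W4.2, crux chain w42 `SigmaMaxModificationsCorridor3` stmt-ResolutionOfSingularities-19249;
# `--supports stmt-ResolutionOfSingularities-19249 --as helper`; res-L1-w42-plan-1 RULING v3.14-42 part 2 (KG)(2) «(G8) → (G7) → hread_menu»;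
# hand res-D-brk-3 (gen 7), file F1a of DESIGN 17:06:09Z)

PURE COMMUTATIVE ALGEBRA, 0 `def`s, every declaration PROVED; OURS bookkeeping; NOT a statement of Hironaka's manuscript [Hironaka2017] nor of
[CossartPiltant2019]/[CossartJannsenSaito2020]. AI-written, weaker than expert review.

WHAT. For `u` part of a regular system of parameters of a local ring `R` (tree `IsRsopPart`), `T` all indices but `i₀`, and `h ∈ R[X]` of
degree `m ≥ 1`: if every coefficient satisfies `f_{j,X} = coeff_{m−j} h ≡ C(m,j)·(−c)^j·u_{i₀}^{jr} (mod (u_T))` with `c` a UNIT, then `r·e_{i₀}`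
is a SOLVABLE VERTEX of the characteristic polyhedron `Δ(h; u; X)` (CP Def. 2.3), so `Δ` is NOT minimal (`¬ CossartPiltant.IsMinimal u h`).
This is the combinatorial heart of CP 2019 Prop. 2.3 («`0` is not a solvable vertex ⇒ `λ = 0`») read over the generic point of the
codimension-two face `V(u_T)`, derived here from FULL minimality (`R/(u_T)` has the single parameter `ū_{i₀}`).

* §1 `mem_map_C_sup_span_X_iff`, `coeff_mem_pow_of_mem_pow_map_C_sup_span_X` — the ideal `𝔭·R[X] + (X)` and the coefficients of its powers
  (used by part 2 for the legality).
* §2 `isPrime_span_image_of_isRsopPart`, `exists_pos_of_mem_minExponents_of_mem_span` (exponents of an element of `(u_T)` involve `T`),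
  `nsmul_single_mem_minExponents_of_sub_mem` (for `f ≡ κ·u_{i₀}^N`, `κ` a unit: `N·e_{i₀} ∈ 𝐒(f)` is the only `T`-free minimal exponent and
  `γ̄(f, N·e_{i₀}) = κ̄`), **`not_isMinimal_of_coeff_sub_mem_span`** (the solvable vertex, weight `α = (r·m+1 on T, 1 at i₀)`).

Equicharacteristic enters only as «every natural number is `0` or a unit in `R`» (the binomials `C(m,j)`). Part 2: `…CPFrameFaceReading`.

References: V. Cossart, O. Piltant, J. Algebra 529 (2019) = arXiv:1412.0868v1, Prop. 2.1, Def. 2.2–2.4, Prop. 2.3 (pp. 10–12) [CossartPiltant2019];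
tree `Literature…CharPolyhedronSolvableVertex` (`IsMinimal`, `IsSolvableVertex`, `minExponents`, `coeffClass`), `Literature…MonomialIdealsRegularParameters`.
-/

noncomputable section

set_option linter.dupNamespace false

open IsLocalRing Polynomial Finset
open Literature.AlgebraicGeometry.Resolution Literature.AlgebraicGeometry.Resolution.CossartPiltant

universe u

namespace Summit.ResolutionOfSingularities.ResolutionOfSingularities.Theorems.SigmaMaxModificationsCorridor3.Helpers

/-! ## §1. The ideal `𝔭·R[X] + (X)` and the coefficients of its powers -/

section PolyIdeal

variable {R : Type u} [CommRing R] (𝔭 : Ideal R)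

/-- `g ∈ 𝔭·R[X] + (X) ⟺ g(0) ∈ 𝔭`. [folklore] -/
theorem mem_map_C_sup_span_X_iff (g : R[X]) :
    g ∈ 𝔭.map (C : R →+* R[X]) ⊔ Ideal.span {X} ↔ g.coeff 0 ∈ 𝔭 := by
  constructor
  · intro hg
    obtain ⟨a, ha, b, hb, rfl⟩ := Submodule.mem_sup.mp hg
    rw [coeff_add]
    refine 𝔭.add_mem ?_ ?_
    · rw [Ideal.mem_map_C_iff] at ha
      exact ha 0
    · obtain ⟨c, rfl⟩ := Ideal.mem_span_singleton'.mp hb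
      simp
  · intro hg
    have hdec : g = C (g.coeff 0) + X * g.divX := by
      conv_lhs => rw [← X_mul_divX_add g]
      ring
    rw [hdec]
    exact Submodule.add_mem_sup (Ideal.mem_map_of_mem _ hg) (Ideal.mem_span_singleton'.mpr ⟨g.divX, mul_comm _ _⟩)

/-- The coefficients of an element of `(𝔭·R[X] + (X))^k`: `coeff_l ∈ 𝔭^{k-l}`. [folklore] -/
theorem coeff_mem_pow_of_mem_pow_map_C_sup_span_X {k : ℕ} {g : R[X]}
    (hg : g ∈ (𝔭.map (C : R →+* R[X]) ⊔ Ideal.span {X}) ^ k) (l : ℕ) : g.coeff l ∈ 𝔭 ^ (k - l) := by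
  induction k generalizing g l with
  | zero => simp
  | succ k ih =>
    rw [pow_succ] at hg
    refine Submodule.mul_induction_on hg (fun a ha b hb => ?_) (fun a b ha hb => ?_)
    · rw [coeff_mul]
      refine Ideal.sum_mem _ fun x hx => ?_
      have hx' := Finset.mem_antidiagonal.mp hx
      have h1 : a.coeff x.1 ∈ 𝔭 ^ (k - x.1) := ih ha x.1
      rcases Nat.eq_zero_or_pos x.2 with h0 | hpos
      · have h2 : b.coeff 0 ∈ 𝔭 := (mem_map_C_sup_span_X_iff 𝔭 b).mp hb
        rw [h0]
        have h3 : a.coeff x.1 * b.coeff 0 ∈ 𝔭 ^ (k - x.1) * 𝔭 := Ideal.mul_mem_mul h1 h2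
        rw [← pow_succ] at h3
        exact Ideal.pow_le_pow_right (by omega) h3
      · have h3 : a.coeff x.1 * b.coeff x.2 ∈ 𝔭 ^ (k - x.1) := Ideal.mul_mem_right _ _ h1
        exact Ideal.pow_le_pow_right (by omega) h3
    · rw [coeff_add]
      exact Ideal.add_mem _ ha hb

end PolyIdeal

/-! ## §2. The solvable vertex forced by a congruence `h ≡ (X − c·u_{i₀}^r)^m (mod (u_T))`, `c` a unit -/

section Vertex

variable {R : Type u} [CommRing R] [IsLocalRing R] {n : ℕ} {u : Fin n → R}

/-- The ideal `(u_t : t ∈ T)` of a sub-family of a part of an r.s.p. is prime. [cite: Matsumura1987, Thm. 14.3] -/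
theorem isPrime_span_image_of_isRsopPart (hz : IsRsopPart u) (T : Finset (Fin n)) : (Ideal.span (u '' ↑T)).IsPrime := by
  classical
  have h := (hz.comp (T.orderEmbOfFin rfl) (T.orderEmbOfFin rfl).injective).isPrime_span_range
  rwa [Set.range_comp, Finset.range_orderEmbOfFin] at h

/-- Every minimal exponent of an element of `(u_t : t ∈ T)` involves some `t ∈ T`. [cite: CossartPiltant2019, Prop. 2.1 (arXiv v1 p. 10)] -/
theorem exists_pos_of_mem_minExponents_of_mem_span (hz : IsRsopPart u) (T : Finset (Fin n)) {f : R}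
    (hf : f ∈ Ideal.span (u '' ↑T)) {a : Fin n → ℕ} (ha : a ∈ minExponents u f) : ∃ t ∈ T, 0 < a t := by
  obtain ⟨-, -, href⟩ := hz.minExponents_spec f
  have hB : f ∈ Ideal.span (uPow u '' ((fun t => Pi.single t 1) '' (↑T : Set (Fin n)))) := by
    refine (Ideal.span_mono ?_) hf
    rintro _ ⟨t, ht, rfl⟩
    exact ⟨Pi.single t 1, ⟨t, ht, rfl⟩, uPow_single u t⟩
  obtain ⟨b, ⟨t, ht, rfl⟩, hle⟩ := href _ hB a ha
  refine ⟨t, ht, lt_of_lt_of_le ?_ (hle t)⟩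
  simp

/-- **Minimal exponents of `f ≡ κ·u_{i₀}^N (mod (u_T))`**, `κ` a unit, `T ∪ {i₀}` all indices: `N e_{i₀} ∈ 𝐒(f)`, it is the only exponent
of `𝐒(f)` free of `T`, and `γ̄(f, N e_{i₀}) = κ̄`. [cite: CossartPiltant2019, Prop. 2.1 (arXiv v1 p. 10)] -/
theorem nsmul_single_mem_minExponents_of_sub_mem (hz : IsRsopPart u) (T : Finset (Fin n)) (i₀ : Fin n) (hi₀ : i₀ ∉ T)
    (hT : ∀ j, j ∉ T → j = i₀) {f κ : R} (hκ : IsUnit κ) (N : ℕ) (hf : f - κ * u i₀ ^ N ∈ Ideal.span (u '' ↑T)) :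
    N • (Pi.single i₀ 1 : Fin n → ℕ) ∈ minExponents u f ∧
      (∀ a ∈ minExponents u f, (∀ t ∈ T, a t = 0) → a = N • Pi.single i₀ 1) ∧
      coeffClass u f (N • Pi.single i₀ 1) = Ideal.Quotient.mk _ κ := by
  classical
  set 𝔭 := Ideal.span (u '' ↑T) with h𝔭
  set e : Fin n → ℕ := Pi.single i₀ 1 with he
  have hprime : 𝔭.IsPrime := isPrime_span_image_of_isRsopPart hz T
  have hu0 : u i₀ ∉ 𝔭 := hz.not_mem_span_image (S := (↑T : Set (Fin n))) (fun h => hi₀ (Finset.mem_coe.mp h))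
  have hpowN : ∀ k : ℕ, u i₀ ^ k ∉ 𝔭 := fun k hk => hu0 (hprime.mem_of_pow_mem k hk)
  have huPow : ∀ k : ℕ, uPow u (k • e) = u i₀ ^ k := fun k => by rw [he, uPow_nsmul, uPow_single]
  have h𝔭le : 𝔭 ≤ maximalIdeal R :=
    (Ideal.span_mono (Set.image_subset_range _ _)).trans hz.span_range_le_maximalIdeal
  obtain ⟨hanti, hmem, href⟩ := hz.minExponents_spec f
  -- monomials involving some `t ∈ T` lie in `𝔭`
  have hmon𝔭 : ∀ a : Fin n → ℕ, (∃ t ∈ T, 0 < a t) → uPow u a ∈ 𝔭 := by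
    rintro a ⟨t, ht, hat⟩
    obtain ⟨c, hc⟩ := dvd_uPow_of_pos u hat
    rw [hc]
    exact Ideal.mul_mem_right _ _ (Ideal.subset_span ⟨t, ht, rfl⟩)
  -- the shape of the exponents of `f`
  have hB : f ∈ Ideal.span (uPow u '' (((fun t => Pi.single t 1) '' (↑T : Set (Fin n))) ∪ {N • e})) := by
    have h1 : κ * u i₀ ^ N ∈ Ideal.span (uPow u '' (((fun t => Pi.single t 1) '' (↑T : Set (Fin n))) ∪ {N • e})) := by
      rw [← huPow]
      exact Ideal.mul_mem_left _ _ (Ideal.subset_span ⟨N • e, Or.inr rfl, rfl⟩)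
    have h2 : f - κ * u i₀ ^ N ∈ Ideal.span (uPow u '' (((fun t => Pi.single t 1) '' (↑T : Set (Fin n))) ∪ {N • e})) := by
      refine (Ideal.span_mono ?_) hf
      rintro _ ⟨t, ht, rfl⟩
      exact ⟨Pi.single t 1, Or.inl ⟨t, ht, rfl⟩, uPow_single u t⟩
    have := Ideal.add_mem _ h2 h1
    rwa [sub_add_cancel] at this
  have hshape : ∀ a ∈ minExponents u f, (∃ t ∈ T, 0 < a t) ∨ (a = a i₀ • e ∧ N ≤ a i₀) := by
    intro a ha
    by_cases hex : ∃ t ∈ T, 0 < a t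
    · exact Or.inl hex
    · right
      push Not at hex
      have hae : a = a i₀ • e := by
        funext j
        by_cases hj : j = i₀
        · subst hj; simp [he]
        · have hjT : j ∈ T := by
            by_contra hjT
            exact hj (hT j hjT)
          have := hex j hjT
          simp [he, hj, Nat.le_zero.mp this]
      refine ⟨hae, ?_⟩
      obtain ⟨b, hb, hle⟩ := href _ hB a ha
      rcases hb with ⟨t, ht, rfl⟩ | hb
      · exact absurd (hle t) (by simp [Nat.le_zero.mp (hex t ht)])
      · rw [Set.mem_singleton_iff] at hb
        subst hb
        have := hle i₀
        simpa [he] using this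
  -- (a) `N e ∈ 𝐒(f)`
  have hNmem : N • e ∈ minExponents u f := by
    by_contra hN
    have hle : Ideal.span (uPow u '' ↑(minExponents u f)) ≤ 𝔭 ⊔ Ideal.span {u i₀ ^ (N + 1)} := by
      rw [Ideal.span_le]
      rintro _ ⟨a, ha, rfl⟩
      rcases hshape a ha with h1 | ⟨hae, hNa⟩
      · exact Ideal.mem_sup_left (hmon𝔭 a h1)
      · have hne : a i₀ ≠ N := fun h => hN (by rw [hae, h] at ha; exact ha)
        have hlt : N + 1 ≤ a i₀ := by omega
        apply Ideal.mem_sup_right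
        rw [hae, huPow, Ideal.mem_span_singleton]
        exact pow_dvd_pow _ hlt
    have hmem' : κ * u i₀ ^ N ∈ 𝔭 ⊔ Ideal.span {u i₀ ^ (N + 1)} := by
      have := Ideal.sub_mem _ (hle hmem) (Ideal.mem_sup_left hf : f - κ * u i₀ ^ N ∈ 𝔭 ⊔ Ideal.span {u i₀ ^ (N + 1)})
      rwa [sub_sub_cancel] at this
    obtain ⟨p, hp, q, hq, hpq⟩ := Submodule.mem_sup.mp hmem'
    obtain ⟨d, rfl⟩ := Ideal.mem_span_singleton'.mp hq
    have hp' : u i₀ ^ N * (κ - d * u i₀) ∈ 𝔭 := by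
      have : p = κ * u i₀ ^ N - d * u i₀ ^ (N + 1) := by rw [← hpq]; ring
      rw [this] at hp
      convert hp using 1
      ring
    rcases hprime.mem_or_mem hp' with h1 | h1
    · exact hpowN N h1
    · have hκm : κ ∈ maximalIdeal R := by
        have := Ideal.add_mem _ (h𝔭le h1) (Ideal.mul_mem_left _ d (hz.mem_maximalIdeal i₀))
        rwa [sub_add_cancel] at this
      exact (IsLocalRing.mem_maximalIdeal _).mp hκm hκ
  -- (b) uniqueness of the `T`-free exponent
  have huniq : ∀ a ∈ minExponents u f, (∀ t ∈ T, a t = 0) → a = N • e := by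
    intro a ha haT
    rcases hshape a ha with ⟨t, ht, hat⟩ | ⟨hae, hNa⟩
    · exact absurd (haT t ht) (by omega)
    · by_contra hne
      have hle : N • e ≤ a := by
        rw [hae]
        intro j
        simp only [he, Pi.smul_apply, smul_eq_mul]
        exact Nat.mul_le_mul_right _ hNa
      exact hanti hNmem ha (Ne.symm hne) hle
  refine ⟨hNmem, huniq, ?_⟩
  -- (c) the coefficient class
  obtain ⟨γ, hγ⟩ := exists_expansion_minExponents u hmem
  rw [coeffClass_eq_mk u hz.mem_span_image_of_mul_mem hanti hγ hNmem, Ideal.Quotient.eq]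
  have hrest : ∑ b ∈ (minExponents u f).erase (N • e), γ b * uPow u b ∈ 𝔭 := by
    refine Ideal.sum_mem _ fun b hb => ?_
    obtain ⟨hbne, hbmem⟩ := Finset.mem_erase.mp hb
    rcases hshape b hbmem with h1 | ⟨hbe, -⟩
    · exact Ideal.mul_mem_left _ _ (hmon𝔭 b h1)
    · exfalso
      refine hbne (huniq b hbmem fun t ht => ?_)
      rw [hbe]
      have hti : t ≠ i₀ := fun h => hi₀ (h ▸ ht)
      simp [he, hti]
  have hfγ : f - γ (N • e) * u i₀ ^ N ∈ 𝔭 := by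
    have h1 : f = γ (N • e) * uPow u (N • e) + ∑ b ∈ (minExponents u f).erase (N • e), γ b * uPow u b :=
      calc f = ∑ b ∈ minExponents u f, γ b * uPow u b := hγ
        _ = _ := (Finset.add_sum_erase _ _ hNmem).symm
    rw [huPow] at h1
    rw [h1, add_sub_cancel_left]
    exact hrest
  have hdiff : u i₀ ^ N * (γ (N • e) - κ) ∈ 𝔭 := by
    have := Ideal.sub_mem _ hf hfγ
    convert this using 1
    ring
  rcases hprime.mem_or_mem hdiff with h1 | h1
  · exact absurd h1 (hpowN N)
  · exact (Ideal.span_mono (Set.image_subset_range _ _)) h1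

/-- **The congruence `f_{j,X} ≡ C(m,j)(−c)^j u_{i₀}^{rj} (mod (u_T))` for all `j`, `c` a unit, makes `r·e_{i₀}` a SOLVABLE VERTEX of
`Δ(h; u; X)`** (so `Δ` is not minimal). Equicharacteristic hypothesis: every natural number is `0` or a unit in `R`.
[cite: CossartPiltant2019, Def. 2.3–2.4, proof of Prop. 2.3 (arXiv v1 pp. 11–12)] -/
theorem not_isMinimal_of_coeff_sub_mem_span (hz : IsRsopPart u) (T : Finset (Fin n)) (i₀ : Fin n) (hi₀ : i₀ ∉ T)
    (hT : ∀ j, j ∉ T → j = i₀) (hchar : ∀ k : ℕ, (k : R) ≠ 0 → IsUnit (k : R))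
    {h : R[X]} (hm : 0 < h.natDegree) {c : R} (hc : IsUnit c) (r : ℕ)
    (hcoef : ∀ j ∈ Finset.Icc 1 h.natDegree,
      h.coeff (h.natDegree - j) - (h.natDegree.choose j : R) * (-c) ^ j * u i₀ ^ (j * r) ∈ Ideal.span (u '' ↑T)) :
    ¬ IsMinimal u h := by
  classical
  intro hmin
  set m := h.natDegree with hmdef
  set e : Fin n → ℕ := Pi.single i₀ 1 with he
  haveI : Nontrivial R := inferInstance
  -- per-coefficient facts
  have hcase : ∀ j ∈ Finset.Icc 1 m,
      ((m.choose j : R) = 0 ∧ ∀ a ∈ minExponents u (h.coeff (m - j)), ∃ t ∈ T, 0 < a t) ∨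
      (IsUnit ((m.choose j : R) * (-c) ^ j) ∧ (j * r) • e ∈ minExponents u (h.coeff (m - j)) ∧
        (∀ a ∈ minExponents u (h.coeff (m - j)), (∀ t ∈ T, a t = 0) → a = (j * r) • e) ∧
        coeffClass u (h.coeff (m - j)) ((j * r) • e) = Ideal.Quotient.mk _ ((m.choose j : R) * (-c) ^ j)) := by
    intro j hj
    by_cases hCj : (m.choose j : R) = 0
    · left
      refine ⟨hCj, fun a ha => exists_pos_of_mem_minExponents_of_mem_span hz T ?_ ha⟩
      have := hcoef j hj
      rwa [hCj, zero_mul, zero_mul, sub_zero] at this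
    · right
      have hunit : IsUnit ((m.choose j : R) * (-c) ^ j) := (hchar _ hCj).mul (hc.neg.pow j)
      exact ⟨hunit, nsmul_single_mem_minExponents_of_sub_mem hz T i₀ hi₀ hT hunit (j * r) (hcoef j hj)⟩
  -- the weight vector
  set L : ℝ := (r : ℝ) * m + 1 with hL
  set α : Fin n → ℝ := fun j => if j = i₀ then 1 else L with hα
  have hLpos : 0 < L := by positivity
  have hαpos : ∀ j, 0 < α j := fun j => by
    simp only [hα]
    split_ifs
    · exact one_pos
    · exact hLpos
  have hwx : ∑ j, α j * (((r • e) j : ℕ) : ℝ) = r := by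
    rw [Finset.sum_eq_single i₀]
    · simp [hα, he]
    · intro j _ hj
      simp [he, hj]
    · intro h; exact absurd (Finset.mem_univ _) h
  have hweight_nsmul : ∀ k : ℕ, weight α (k • e) = k := fun k => by
    rw [weight_nsmul, he, weight_single]
    simp [hα]
  have hweight_big : ∀ a : Fin n → ℕ, (∃ t ∈ T, 0 < a t) → L ≤ weight α a := by
    rintro a ⟨t, ht, hat⟩
    have hti : t ≠ i₀ := fun h => hi₀ (h ▸ ht)
    calc L = α t * 1 := by simp [hα, hti]
      _ ≤ α t * (a t : ℝ) := by
          apply mul_le_mul_of_nonneg_left _ (hαpos t).le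
          exact_mod_cast hat
      _ ≤ weight α a := by
          unfold weight
          exact Finset.single_le_sum (f := fun l => α l * (a l : ℝ)) (fun l _ => mul_nonneg (hαpos l).le (Nat.cast_nonneg _))
            (Finset.mem_univ t)
  refine hmin (r • e) ⟨⟨α, hαpos, ?_, ?_⟩, c, ?_⟩
  · -- every generating point lies on or above the level `r`, with equality only at `r e`
    intro j hj a ha
    have hj' := Finset.mem_Icc.mp hj
    have hjpos : (0 : ℝ) < j := by exact_mod_cast hj'.1
    rw [hwx]
    rcases hcase j hj with ⟨-, hall⟩ | ⟨-, hmemj, huniqj, -⟩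
    · have hbig := hweight_big a (hall a ha)
      have hlt : (r : ℝ) < weight α a / j := by
        rw [lt_div_iff₀ hjpos]
        calc (r : ℝ) * j ≤ r * m := by
              apply mul_le_mul_of_nonneg_left _ (Nat.cast_nonneg _)
              exact_mod_cast hj'.2
          _ < L := by rw [hL]; linarith
          _ ≤ weight α a := hbig
      exact ⟨hlt.le, fun heq => absurd heq hlt.ne'⟩
    · by_cases hex : ∃ t ∈ T, 0 < a t
      · have hbig := hweight_big a hex
        have hlt : (r : ℝ) < weight α a / j := by
          rw [lt_div_iff₀ hjpos]
          calc (r : ℝ) * j ≤ r * m := by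
                apply mul_le_mul_of_nonneg_left _ (Nat.cast_nonneg _)
                exact_mod_cast hj'.2
            _ < L := by rw [hL]; linarith
            _ ≤ weight α a := hbig
        exact ⟨hlt.le, fun heq => absurd heq hlt.ne'⟩
      · push Not at hex
        have haeq := huniqj a ha fun t ht => Nat.le_zero.mp (hex t ht)
        subst haeq
        have hw : weight α ((j * r) • e) / j = r := by
          rw [hweight_nsmul, Nat.cast_mul, mul_comm, mul_div_assoc, div_self hjpos.ne', mul_one]
        refine ⟨hw.ge, fun _ => ?_⟩
        funext l
        by_cases hl : l = i₀
        · subst hl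
          simp [he]
          field_simp
        · simp [he, hl]
  · -- `r e` is a generating point: the exponent `(m r) e_{i₀}` of `f_{m,X}`
    refine ⟨m, Finset.mem_Icc.mpr ⟨hm, le_rfl⟩, (m * r) • e, ?_, ?_⟩
    · rcases hcase m (Finset.mem_Icc.mpr ⟨hm, le_rfl⟩) with ⟨h0, -⟩ | ⟨-, hmemj, -, -⟩
      · exfalso
        rw [Nat.choose_self, Nat.cast_one] at h0
        exact one_ne_zero h0
      · exact hmemj
    · have hmpos : (0 : ℝ) < m := by exact_mod_cast hm
      funext l
      by_cases hl : l = i₀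
      · subst hl
        simp [he]
        field_simp
      · simp [he, hl]
  · -- solvability: `γ̄(f_j, j·(r e)) = C(m,j) (−c)^j`
    intro j hj
    rw [smul_smul]
    rcases hcase j hj with ⟨h0, hall⟩ | ⟨-, -, -, hcc⟩
    · rw [h0, zero_mul, map_zero]
      apply coeffClass_eq_zero_of_not_mem
      intro hmemj
      obtain ⟨t, ht, hat⟩ := hall _ hmemj
      have hti : t ≠ i₀ := fun h => hi₀ (h ▸ ht)
      simp [he, hti] at hat
    · exact hcc

end Vertex

end Summit.ResolutionOfSingularities.ResolutionOfSingularities.Theorems.SigmaMaxModificationsCorridor3.Helpers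

end
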